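import Summits.PneNP.PneNP.Theorems.LatticeMagicTargetDefs

/-!
# `stub_game`, part 1/4: game combinatorics (line `SketchIdeator5`, crux `Target`, stmt-PneNP-10709)

Card `kpt-squeeze-ideal-lattice-leg`, §First lemma (one-way + hard-core ⟹ the hard-bit vector game is
hard), combinatorial core: the canonical real teacher "reveal the lowest wrong coordinate", the
simulated teacher "reveal the lowest wrong coordinate other than the planted `j₀`", the
**coincidence lemma** (the two plays agree as long as `j₀` has not been revealed), the set
`goodSet` of planted coordinates for which the simulation answers correctly, and
`simAnswer_eq_of_good`.

## References

* J. Krajíček, arXiv:2506.20221, §2.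
* O. Goldreich, *Foundations of Cryptography I*, CUP 2001, Def. 2.5.1, §2.5.2.
-/

set_option linter.dupNamespace false -- `Summit.PneNP.PneNP` is the mandated summit-side namespace

namespace Summit.PneNP.PneNP.Theorems.LatticeMagicTarget

open Literature.Computability.Complexity
open _root_.Computability

/-! ### 2. Game combinatorics: the canonical teachers and the coincidence lemma -/

namespace StubGame

variable {t : ℕ}

/-- `Wrong B I v j` is a Boolean disequality, hence decidable. -/
instance (B : List Bool → Bool) (I : HBInstance t) (v : List Bool) (j : Fin t) :
    Decidable (Wrong B I v j) :=
  inferInstanceAs (Decidable (_ ≠ _))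

/-- The first element of the list satisfying `P` (default `d`). -/
def firstSat {α : Type} (P : α → Prop) [DecidablePred P] : List α → α → α
  | [], d => d
  | a :: l, d => if P a then a else firstSat P l d

section FirstSat

variable {α : Type} (P : α → Prop) [DecidablePred P]

/-- If some listed element satisfies `P`, the selection satisfies `P` and is listed. -/
theorem firstSat_spec {l : List α} (d : α) (h : ∃ a ∈ l, P a) :
    P (firstSat P l d) ∧ firstSat P l d ∈ l := by
  induction l with
  | nil => simp at h
  | cons a l ih =>
    by_cases ha : P a
    · simp [firstSat, ha]
    · have h' : ∃ b ∈ l, P b := by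
        obtain ⟨b, hb, hPb⟩ := h
        rcases List.mem_cons.1 hb with rfl | hb
        · exact (ha hPb).elim
        · exact ⟨b, hb, hPb⟩
      have := ih h'
      simp [firstSat, ha, this.1, this.2]

/-- If no listed element satisfies `P`, the selection is the default. -/
theorem firstSat_of_forall_not {l : List α} (d : α) (h : ∀ a ∈ l, ¬ P a) : firstSat P l d = d := by
  induction l with
  | nil => rfl
  | cons a l ih =>
    have ha : ¬ P a := h a (by simp)
    simp only [firstSat, ha, if_false]
    exact ih fun b hb => h b (by simp [hb])

/-- The selection is listed or is the default. -/
theorem firstSat_mem_or {l : List α} (d : α) : firstSat P l d ∈ l ∨ firstSat P l d = d := by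
  by_cases h : ∃ a ∈ l, P a
  · exact Or.inl (firstSat_spec P d h).2
  · push Not at h
    exact Or.inr (firstSat_of_forall_not P d h)

/-- When some element satisfies `P` the default is irrelevant. -/
theorem firstSat_default {l : List α} (d d' : α) (h : ∃ a ∈ l, P a) :
    firstSat P l d = firstSat P l d' := by
  induction l with
  | nil => simp at h
  | cons a l ih =>
    by_cases ha : P a
    · simp [firstSat, ha]
    · have h' : ∃ b ∈ l, P b := by
        obtain ⟨b, hb, hPb⟩ := h
        rcases List.mem_cons.1 hb with rfl | hb
        · exact (ha hPb).elim
        · exact ⟨b, hb, hPb⟩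
      simp only [firstSat, ha, if_false]
      exact ih h'

/-- Removing an element that is not the selected one does not change the selection. -/
theorem firstSat_filter_ne [DecidableEq α] {l : List α} (d c : α) (h : firstSat P l d ≠ c) :
    firstSat P (l.filter (· ≠ c)) d = firstSat P l d := by
  induction l with
  | nil => rfl
  | cons a l ih =>
    by_cases ha : P a
    · have hac : a ≠ c := by simpa [firstSat, ha] using h
      rw [List.filter_cons_of_pos (by simpa using hac)]
      simp only [firstSat, ha, if_true]
    · have h' : firstSat P l d ≠ c := by simpa [firstSat, ha] using h
      by_cases hac : a = c
      · rw [List.filter_cons_of_neg (by simpa using hac)]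
        simp only [firstSat, ha, if_false]
        exact ih h'
      · rw [List.filter_cons_of_pos (by simpa using hac)]
        simp only [firstSat, ha, if_false]
        exact ih h'

/-- Transport of `firstSat` along a map. -/
theorem firstSat_map {β : Type} (Q : β → Prop) [DecidablePred Q] (f : α → β) {l : List α}
    (hPQ : ∀ a ∈ l, (P a ↔ Q (f a))) (d : α) :
    firstSat Q (l.map f) (f d) = f (firstSat P l d) := by
  induction l with
  | nil => rfl
  | cons a l ih =>
    have hPQa := hPQ a (by simp)
    have ih' := ih fun b hb => hPQ b (by simp [hb])
    by_cases ha : P a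
    · have : Q (f a) := hPQa.1 ha
      simp [firstSat, ha, this]
    · have : ¬ Q (f a) := fun hq => ha (hPQa.2 hq)
      simp [firstSat, ha, this, ih']

end FirstSat

variable (g : List Bool → List Bool) (B : List Bool → Bool) (S : List Bool → List Bool)

/-- The real teacher: reveal the lowest wrong coordinate (default `d` if none is wrong). -/
def realT (I : HBInstance t) (d : Fin t) : Teacher t :=
  fun v _ => firstSat (Wrong B I v ·) (List.finRange t) d

/-- The candidates of the simulation: all coordinates but the planted one, in increasing order. -/
def cand (t : ℕ) (j₀ : Fin t) : List (Fin t) := (List.finRange t).filter (· ≠ j₀)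

/-- The simulated teacher: reveal the lowest wrong coordinate other than `j₀` (default `d`). -/
def simT (I : HBInstance t) (j₀ d : Fin t) : Teacher t :=
  fun v _ => firstSat (Wrong B I v ·) (cand t j₀) d

/-- The real teacher is legal. -/
theorem realT_legal (I : HBInstance t) (d : Fin t) (k : ℕ) : HBLegal g B S (realT B I d) I k := by
  intro r _ hex
  obtain ⟨j, hj⟩ := hex
  exact (firstSat_spec (Wrong B I (hbProposal g S (realT B I d) I r) ·) d
    ⟨j, List.mem_finRange j, hj⟩).1

/-- **Coincidence lemma.** As long as every proposal has had a wrong coordinate and the real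
teacher has not revealed `j₀`, the play against the simulated teacher has the same history. -/
theorem hbHist_sim_eq (I : HBInstance t) {j₀ d d₀ : Fin t} :
    ∀ r, (∀ r' < r, (∃ j, Wrong B I (hbProposal g S (realT B I d₀) I r') j) ∧
        realT B I d₀ (hbProposal g S (realT B I d₀) I r') (hbHist g S (realT B I d₀) I r') ≠ j₀) →
      hbHist g S (simT B I j₀ d) I r = hbHist g S (realT B I d₀) I r
  | 0, _ => rfl
  | r + 1, h => by
    have ih := hbHist_sim_eq I (d := d) r fun r' hr' => h r' (Nat.lt_succ_of_lt hr')
    obtain ⟨hex, hr⟩ := h r r.lt_succ_self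
    have hpick : ∀ v hh, (∃ j, Wrong B I v j) → realT B I d₀ v hh ≠ j₀ →
        simT B I j₀ d v hh = realT B I d₀ v hh := by
      intro v hh hexv hne
      have hdef : realT B I d₀ v hh = realT B I d v hh :=
        firstSat_default _ d₀ d (by obtain ⟨j, hj⟩ := hexv; exact ⟨j, List.mem_finRange j, hj⟩)
      rw [hdef] at hne ⊢
      exact firstSat_filter_ne _ d j₀ hne
    have hex' : ∃ j, Wrong B I (S (hbView g I (hbHist g S (realT B I d₀) I r))) j := hex
    have hr' : realT B I d₀ (S (hbView g I (hbHist g S (realT B I d₀) I r)))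
        (hbHist g S (realT B I d₀) I r) ≠ j₀ := hr
    show (let hh := hbHist g S (simT B I j₀ d) I r
          let v := S (hbView g I hh)
          let j := simT B I j₀ d v hh
          hh ++ [((j : ℕ), I.u j)]) =
         (let hh := hbHist g S (realT B I d₀) I r
          let v := S (hbView g I hh)
          let j := realT B I d₀ v hh
          hh ++ [((j : ℕ), I.u j)])
    simp only []
    rw [ih, hpick _ _ hex' hr']

/-- Scanning the rounds `r, r+1, …, r+m-1`: answer `bit r` at the first round with `ok r`. -/
def scanOut (ok : ℕ → Bool) (bit : ℕ → Bool) : ℕ → ℕ → Bool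
  | _, 0 => false
  | r, m + 1 => if ok r then bit r else scanOut ok bit (r + 1) m

open scoped Classical in
/-- The good planted coordinates `j₀` of an instance: `S` wins against the real teacher at a round
`r < k` before which every proposal had a wrong coordinate and `j₀` was never revealed. -/
noncomputable def goodSet (k : ℕ) (I : HBInstance t) (d₀ : Fin t) : Finset (Fin t) :=
  Finset.univ.filter fun j₀ => ∃ r < k, (∀ j, ¬ Wrong B I (hbProposal g S (realT B I d₀) I r) j) ∧
    ∀ r' < r, (∃ j, Wrong B I (hbProposal g S (realT B I d₀) I r') j) ∧
      realT B I d₀ (hbProposal g S (realT B I d₀) I r') (hbHist g S (realT B I d₀) I r') ≠ j₀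

/-- Membership in `goodSet`, unfolded. -/
theorem mem_goodSet {k : ℕ} {I : HBInstance t} {d₀ j₀ : Fin t} :
    j₀ ∈ goodSet g B S k I d₀ ↔ ∃ r < k, (∀ j, ¬ Wrong B I (hbProposal g S (realT B I d₀) I r) j) ∧
      ∀ r' < r, (∃ j, Wrong B I (hbProposal g S (realT B I d₀) I r') j) ∧
        realT B I d₀ (hbProposal g S (realT B I d₀) I r') (hbHist g S (realT B I d₀) I r') ≠ j₀ := by
  unfold goodSet
  rw [Finset.mem_filter]
  simp

/-- The predictor's answer read off the simulated play: at the first round `< k` in which all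
candidate coordinates are right, the proposal's bit at `j₀`. -/
def simAnswer (k : ℕ) (I : HBInstance t) (j₀ d : Fin t) : Bool :=
  scanOut (fun r => decide (∀ i ∈ cand t j₀, ¬ Wrong B I (hbProposal g S (simT B I j₀ d) I r) i))
    (fun r => (hbProposal g S (simT B I j₀ d) I r).getD j₀ false) 0 k

/-- **On the good event the predictor answers `B (u_{j₀})`.** -/
theorem simAnswer_eq_of_good {k : ℕ} {I : HBInstance t} {j₀ d d₀ : Fin t}
    (hgood : j₀ ∈ goodSet g B S k I d₀) : simAnswer g B S k I j₀ d = B (I.u j₀) := by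
  obtain ⟨r, hrk, hwin, hnot⟩ := (mem_goodSet g B S).1 hgood
  -- proposals coincide up to round `r`
  have hprop : ∀ s ≤ r, hbProposal g S (simT B I j₀ d) I s = hbProposal g S (realT B I d₀) I s := by
    intro s hs
    simp only [hbProposal]
    rw [hbHist_sim_eq g B S I s fun r' hr' => hnot r' (lt_of_lt_of_le hr' hs)]
  unfold simAnswer
  set ok : ℕ → Bool := fun r =>
    decide (∀ i ∈ cand t j₀, ¬ Wrong B I (hbProposal g S (simT B I j₀ d) I r) i) with hok
  set bit : ℕ → Bool := fun r => (hbProposal g S (simT B I j₀ d) I r).getD j₀ false with hbit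
  suffices H : ∀ m s, s ≤ r → r < s + m → scanOut ok bit s m = B (I.u j₀) by
    exact H k 0 (Nat.zero_le _) (by simpa using hrk)
  intro m
  induction m with
  | zero => intro s hs hlt; omega
  | succ m ih =>
    intro s hs hlt
    simp only [scanOut]
    by_cases hoks : ok s = true
    · rw [if_pos hoks]
      have hall : ∀ i ∈ cand t j₀, ¬ Wrong B I (hbProposal g S (realT B I d₀) I s) i := by
        simpa [hok, hprop s hs] using hoks
      -- the coordinate `j₀` is right at round `s` as well
      have hj₀ : ¬ Wrong B I (hbProposal g S (realT B I d₀) I s) j₀ := by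
        rcases Nat.lt_or_eq_of_le hs with hlt' | rfl
        · intro hw
          have hpick := (firstSat_spec (Wrong B I (hbProposal g S (realT B I d₀) I s) ·) d₀
            ⟨j₀, List.mem_finRange j₀, hw⟩)
          have hne := (hnot s hlt').2
          simp only [realT] at hne
          -- the picked coordinate is wrong, hence it is `j₀` (all candidates are right)
          have : firstSat (Wrong B I (hbProposal g S (realT B I d₀) I s) ·) (List.finRange t) d₀ = j₀ := by
            by_contra hne'
            exact hall _ (by simp [cand, hne']) hpick.1
          exact hne this
        · exact hwin j₀
      simp only [hbit, hprop s hs]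
      have h2 : B (I.u j₀) = _ := not_not.1 hj₀
      exact h2.symm
    · rw [if_neg hoks]
      have hsr : s ≠ r := by
        rintro rfl
        apply hoks
        simp only [hok, hprop s le_rfl, decide_eq_true_eq]
        exact fun i _ => hwin i
      exact ih (s + 1) (by omega) (by omega)

end StubGame

/-- **The real teacher is legal** (explicit-binder form, registered sub-goal `stubGame_realT_legal` of
stmt-PneNP-10709): "reveal the lowest wrong coordinate" reveals a wrong coordinate whenever one exists. -/
theorem stubGame_realT_legal (g : List Bool → List Bool) (B : List Bool → Bool) (S : List Bool → List Bool)
    {t : ℕ} (I : HBInstance t) (d : Fin t) (k : ℕ) : HBLegal g B S (StubGame.realT B I d) I k :=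
  StubGame.realT_legal g B S I d k

end Summit.PneNP.PneNP.Theorems.LatticeMagicTarget
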